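import Mathlib.Analysis.SpecialFunctions.Pow.Real
import Mathlib.Analysis.SpecialFunctions.Log.Basic
import Mathlib.Topology.Algebra.InfiniteSum.Real
import HarnessLib

/-!
# Purity propagation for spectral traces: `1 − Z(2t*)∕Z(t*)² < 1∕2` at ONE time forces
# `1 − Z(2t)∕Z(t)² ≤ 2ρ^t` at all later times (`Z(t) = Σᵢ μᵢ^t`, `μᵢ ≥ 0`)

HELPER toward stub **T1** `TwistedSlabAnchor` of LINE `twisted-slab-continuity` (crux `IRcof`, stmt-QuantumFields-26930, census
row 43; LEAD prover ym-ir-line-tsc-p1 g5; `--supports` the crux, `--as helper`).  This is the β-UNIFORMITY LEVER of the T1-box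
programme (K34): combined with the integer-multiplicity spectral representation of `projSlabZ` (K33) and THE NUMBER (K30b∕K31:
`lim_β projSlabDefect(β, t*) = 1 − ∏ tanh²(t*ω∕2) < 1∕2` for `t*` large) it yields `projSlabDefect(β; box, t) ≤ C e^{−ct}` for ALL
`β ≥ β₀(box)` and ALL `t ≥ 1` — T1 at one box, uniformly in the coupling, with no transfer-operator semiclassics.
Theorems only (no definition); pure real analysis, `Mathlib` only.  Setting: a family
`μ : ι → ℝ` of non-negative numbers (the eigenvalues of a positive trace-class ∕ Hilbert–Schmidt transfer operator,
listed WITH multiplicity — a family, so every eigenvalue carries an integer weight) whose power sums converge,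
`Z(t) = Σᵢ μᵢ^t` for `t ≥ t₀` (for a Hilbert–Schmidt operator `t₀ = 2`).  The **purity defect** of the normalised
state `ϱ_t = A^t ∕ Tr A^t` is `D(t) := 1 − Tr ϱ_t² = 1 − Z(2t)∕Z(t)²`.

* `exists_isMax_of_hasSum_pow` — a summable non-negative family with a positive power sum attains its supremum;
* ★ `defect_le_two_mul_pow_of_defect_le` — **purity propagation**: if `0 < Z(t*)` and `D(t*) ≤ δ` with `0 ≤ δ < 1∕2`
  (`t* ≥ 1`, `t* ≥ t₀`), then for every `t ≥ t*`: `D(t) ≤ 2·ρ^t` with `ρ = (δ∕(1−δ))^{1∕t*} < 1`.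
  Mechanism (Reed–Simon IV §XIII.12-style bookkeeping, no operator theory): write `Z(t) = μ₀^t (1 + s_t)`, `μ₀ = max μᵢ`,
  `s_t = Σ_{i ≠ i₀} (μᵢ∕μ₀)^t`; then `s_{2t} ≤ s_t`, so `D(t) ≥ s_t∕(1 + s_t)` and `D(t*) ≤ δ < 1∕2` gives
  `s_{t*} ≤ δ∕(1−δ) < 1` — in particular the top eigenvalue is SIMPLE and every other ratio satisfies
  `(μᵢ∕μ₀)^{t*} ≤ s_{t*}` (integer multiplicity!), i.e. `μᵢ∕μ₀ ≤ ρ`; hence `s_t ≤ ρ^{t−t*} s_{t*} ≤ ρ^t` and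
  `D(t) ≤ 1 − (1 + s_t)⁻² ≤ 2 s_t`;
* `rho_lt_one` bookkeeping inside; ★ `exists_exp_bound_of_defect_le` — the same as `∃ c > 0, ∀ t ≥ t*, D(t) ≤ 2e^{−ct}`.

The point of the lemma: a spectral gap and a bounded excited trace — hence exponential purity UNIFORMLY in any
parameter of the operator — follow from ONE number `D(t*) < 1∕2`, which is accessible to the Laplace method
(`β → ∞` limits of partition-function ratios), with no semiclassical spectral analysis.  With non-integer weights
(`Z(t) = ∫ x^t dν` for a general measure `ν`) the statement is FALSE (`ν = δ₁ + ε·Leb|_{[0,1]}` has `D(t) ≍ ε∕t`).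

References: M. Reed, B. Simon, *Methods of Modern Mathematical Physics IV* (1978) §XIII.12 (ground states, `Tr e^{−tH}`
bookkeeping); B. Simon, *The Statistical Mechanics of Lattice Gases* I (1993) §II.13 (transfer matrices, purity of the
periodic state).  HONEST: an elementary lemma; by itself it says nothing about `β`, `L`, T1, `IRcof`, `IR` or the Yang–Mills
mass gap (Clay: NOT proved); R4 = `BalabanLadder.UV` only.
-/

set_option autoImplicit false

noncomputable section

open Filter Topology Real

namespace Summit.QuantumFields.YangMills.Cruxes.IRcof.TwistedSlab

namespace SpectralPurity

variable {ι : Type*} {μ : ι → ℝ} {Z : ℕ → ℝ} {t₀ : ℕ}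

/-- **A summable non-negative family attains its supremum** once some power sum is positive: if
`Σᵢ μᵢ^{t} = Z(t) > 0` (`t ≥ 1`) then there is `i₀` with `0 < μ_{i₀}` and `μᵢ ≤ μ_{i₀}` for all `i`
(the terms tend to `0` along the cofinite filter, so only finitely many exceed a given positive one). [folklore] -/
theorem exists_isMax_of_hasSum_pow (hμ : ∀ i, 0 ≤ μ i) {t : ℕ} (ht : 1 ≤ t) (hZ : HasSum (fun i => μ i ^ t) (Z t))
    (hpos : 0 < Z t) : ∃ i₀, 0 < μ i₀ ∧ ∀ i, μ i ≤ μ i₀ := by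
  classical
  -- some term is positive
  obtain ⟨i₁, hi₁⟩ : ∃ i, 0 < μ i := by
    by_contra h
    simp only [not_exists, not_lt] at h
    have h0 : ∀ i, μ i = 0 := fun i => le_antisymm (h i) (hμ i)
    have : Z t = 0 := by
      have hz : HasSum (fun _ : ι => (0 : ℝ)) (Z t) := by
        convert hZ using 2 with i
        rw [h0 i, zero_pow (by omega)]
      exact (hasSum_zero.unique hz).symm
    exact hpos.ne' this
  -- only finitely many terms are `≥ μ i₁`
  have hlim : Tendsto (fun i => μ i ^ t) cofinite (𝓝 0) := hZ.summable.tendsto_cofinite_zero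
  have hfin : {i | μ i₁ ≤ μ i}.Finite := by
    have hev : ∀ᶠ i in cofinite, μ i ^ t < μ i₁ ^ t := hlim (gt_mem_nhds (pow_pos hi₁ t))
    refine (Filter.eventually_cofinite.1 hev).subset fun i hi => ?_
    simp only [Set.mem_setOf_eq, not_lt] at hi ⊢
    exact pow_le_pow_left₀ hi₁.le hi t
  obtain ⟨i₀, hi₀mem, hmax⟩ := hfin.toFinset.exists_max_image μ ⟨i₁, by simp⟩
  have hi₀ : μ i₁ ≤ μ i₀ := by simpa using hi₀mem
  refine ⟨i₀, hi₁.trans_le hi₀, fun i => ?_⟩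
  by_cases h : μ i₁ ≤ μ i
  · exact hmax i (by simpa using h)
  · exact ((not_le.1 h).le).trans hi₀

open Classical in
/-- The data extracted from the top eigenvalue: with `μ₀ = μ_{i₀}` maximal and positive, the normalised power sum
`Z(t)∕μ₀^t − 1` is the sum `s_t = Σ_{i ≠ i₀} (μᵢ∕μ₀)^t` of the non-top ratios (as a `HasSum` over the family with the
top term replaced by `0`). [folklore] -/
theorem hasSum_ratio_pow_ite {i₀ : ι} (h0 : 0 < μ i₀) {t : ℕ} (hZ : HasSum (fun i => μ i ^ t) (Z t)) :
    HasSum (fun i => if i = i₀ then 0 else (μ i / μ i₀) ^ t) (Z t / μ i₀ ^ t - 1) := by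
  classical
  have hm : μ i₀ ^ t ≠ 0 := pow_ne_zero _ h0.ne'
  have h1 : HasSum (fun i => (μ i / μ i₀) ^ t) (Z t / μ i₀ ^ t) := by
    simp_rw [div_pow]
    exact hZ.div_const _
  have h2 := hasSum_ite_sub_hasSum h1 i₀
  rwa [div_self h0.ne', one_pow] at h2

/-- `s_t ≥ 0`. [folklore] -/
theorem ratioSum_nonneg (hμ : ∀ i, 0 ≤ μ i) {i₀ : ι} (h0 : 0 < μ i₀) {t : ℕ}
    (hZ : HasSum (fun i => μ i ^ t) (Z t)) : 0 ≤ Z t / μ i₀ ^ t - 1 := by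
  classical
  refine (hasSum_ratio_pow_ite h0 hZ).nonneg fun i => ?_
  split_ifs
  · exact le_rfl
  · exact pow_nonneg (div_nonneg (hμ i) h0.le) _

/-- `s_{2t} ≤ s_t`: every ratio lies in `[0, 1]`. [folklore] -/
theorem ratioSum_two_mul_le (hμ : ∀ i, 0 ≤ μ i) {i₀ : ι} (h0 : 0 < μ i₀) (hmax : ∀ i, μ i ≤ μ i₀) {t : ℕ}
    (hZ : HasSum (fun i => μ i ^ t) (Z t)) (hZ2 : HasSum (fun i => μ i ^ (2 * t)) (Z (2 * t))) :
    Z (2 * t) / μ i₀ ^ (2 * t) - 1 ≤ Z t / μ i₀ ^ t - 1 := by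
  classical
  refine hasSum_le (fun i => ?_) (hasSum_ratio_pow_ite h0 hZ2) (hasSum_ratio_pow_ite h0 hZ)
  split_ifs
  · exact le_rfl
  · have hr0 : 0 ≤ μ i / μ i₀ := div_nonneg (hμ i) h0.le
    have hr1 : μ i / μ i₀ ≤ 1 := (div_le_one h0).2 (hmax i)
    rw [mul_comm, pow_mul]
    calc ((μ i / μ i₀) ^ t) ^ 2 = (μ i / μ i₀) ^ t * (μ i / μ i₀) ^ t := sq _
      _ ≤ (μ i / μ i₀) ^ t * 1 := by
          gcongr
          exact pow_le_one₀ hr0 hr1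
      _ = (μ i / μ i₀) ^ t := mul_one _

/-- **Every non-top ratio is controlled by `s_{t*}`** (integer multiplicity): for `i ≠ i₀`,
`(μᵢ∕μ₀)^{t} ≤ s_{t}`. [folklore] -/
theorem ratio_pow_le_ratioSum (hμ : ∀ i, 0 ≤ μ i) {i₀ : ι} (h0 : 0 < μ i₀) {t : ℕ}
    (hZ : HasSum (fun i => μ i ^ t) (Z t)) {i : ι} (hi : i ≠ i₀) :
    (μ i / μ i₀) ^ t ≤ Z t / μ i₀ ^ t - 1 := by
  classical
  have h := le_hasSum (hasSum_ratio_pow_ite h0 hZ) i fun j _ => ?_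
  · simpa [hi] using h
  · split_ifs
    · exact le_rfl
    · exact pow_nonneg (div_nonneg (hμ j) h0.le) _

/-- **Geometric decay of the excited sum**: if every non-top ratio is `≤ ρ` then `s_t ≤ ρ^{t − t*} · s_{t*}` for
`t ≥ t*`. [folklore] -/
theorem ratioSum_le_pow_mul (hμ : ∀ i, 0 ≤ μ i) {i₀ : ι} (h0 : 0 < μ i₀) {ρ : ℝ}
    (hrat : ∀ i, i ≠ i₀ → μ i / μ i₀ ≤ ρ) {ts t : ℕ} (hts : ts ≤ t)
    (hZs : HasSum (fun i => μ i ^ ts) (Z ts)) (hZ : HasSum (fun i => μ i ^ t) (Z t)) :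
    Z t / μ i₀ ^ t - 1 ≤ ρ ^ (t - ts) * (Z ts / μ i₀ ^ ts - 1) := by
  classical
  refine hasSum_le (fun i => ?_) (hasSum_ratio_pow_ite h0 hZ) ((hasSum_ratio_pow_ite h0 hZs).mul_left _)
  split_ifs with h
  · simp
  · have hr0 : 0 ≤ μ i / μ i₀ := div_nonneg (hμ i) h0.le
    calc (μ i / μ i₀) ^ t = (μ i / μ i₀) ^ (t - ts) * (μ i / μ i₀) ^ ts := by
          rw [← pow_add, Nat.sub_add_cancel hts]
      _ ≤ ρ ^ (t - ts) * (μ i / μ i₀) ^ ts := by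
          gcongr
          exact hrat i h

/-- The defect in terms of the excited sums: `1 − Z(2t)∕Z(t)² = 1 − (1 + s_{2t})∕(1 + s_t)²`. [folklore] -/
theorem defect_eq {i₀ : ι} (h0 : 0 < μ i₀) (t : ℕ) :
    1 - Z (2 * t) / Z t ^ 2 =
      1 - (1 + (Z (2 * t) / μ i₀ ^ (2 * t) - 1)) / (1 + (Z t / μ i₀ ^ t - 1)) ^ 2 := by
  have hm : μ i₀ ^ t ≠ 0 := pow_ne_zero _ h0.ne'
  have hm2 : μ i₀ ^ (2 * t) = (μ i₀ ^ t) ^ 2 := by rw [mul_comm, pow_mul]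
  rw [hm2]
  congr 1
  field_simp
  ring

/-- Elementary: for `s ≥ 0` and `0 ≤ s₂ ≤ s`, `s∕(1+s) ≤ 1 − (1 + s₂)∕(1 + s)²`. [folklore] -/
theorem div_le_defect {s s₂ : ℝ} (hs : 0 ≤ s) (hs₂ : s₂ ≤ s) :
    s / (1 + s) ≤ 1 - (1 + s₂) / (1 + s) ^ 2 := by
  have h1 : (1 + s) ≠ 0 := by positivity
  have key : 1 - (1 + s₂) / (1 + s) ^ 2 - s / (1 + s) = (s - s₂) / (1 + s) ^ 2 := by
    field_simp
    ring
  have h2 : 0 ≤ (s - s₂) / (1 + s) ^ 2 := div_nonneg (by linarith) (by positivity)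
  linarith

/-- Elementary: for `s ≥ 0` and `s₂ ≥ 0`, `1 − (1 + s₂)∕(1 + s)² ≤ 2s`. [folklore] -/
theorem defect_le_two_mul {s s₂ : ℝ} (hs : 0 ≤ s) (hs₂ : 0 ≤ s₂) :
    1 - (1 + s₂) / (1 + s) ^ 2 ≤ 2 * s := by
  have h1 : (1 + s) ≠ 0 := by positivity
  have key : 2 * s - (1 - (1 + s₂) / (1 + s) ^ 2) = (3 * s ^ 2 + 2 * s ^ 3 + s₂) / (1 + s) ^ 2 := by
    field_simp
    ring
  have h2 : 0 ≤ (3 * s ^ 2 + 2 * s ^ 3 + s₂) / (1 + s) ^ 2 := div_nonneg (by positivity) (by positivity)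
  linarith

/-- ★ **PURITY PROPAGATION.**  Let `μᵢ ≥ 0` with `Σᵢ μᵢ^t = Z(t)` for all `t ≥ t₀`; let `t* ≥ max(t₀, 1)` with
`0 < Z(t*)` and `1 − Z(2t*)∕Z(t*)² ≤ δ`, `0 ≤ δ < 1∕2`.  Then with `ρ := (δ∕(1−δ))^{1∕t*}` one has `0 ≤ ρ < 1` and,
for every `t ≥ t*`, `1 − Z(2t)∕Z(t)² ≤ 2ρ^t`.  (A simple top eigenvalue, the gap `−log ρ` and the bound on the excited
trace are all read off the single number `δ`; the integer multiplicities are essential.) [folklore] -/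
theorem defect_le_two_mul_pow_of_defect_le (hμ : ∀ i, 0 ≤ μ i)
    (hZ : ∀ t, t₀ ≤ t → HasSum (fun i => μ i ^ t) (Z t)) {ts : ℕ} (ht₀ : t₀ ≤ ts) (hts : 1 ≤ ts)
    (hpos : 0 < Z ts) {δ : ℝ} (hδ0 : 0 ≤ δ) (hδ : δ < 1 / 2) (hD : 1 - Z (2 * ts) / Z ts ^ 2 ≤ δ) :
    0 ≤ (δ / (1 - δ)) ^ (1 / (ts : ℝ)) ∧ (δ / (1 - δ)) ^ (1 / (ts : ℝ)) < 1 ∧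
      ∀ t, ts ≤ t → 1 - Z (2 * t) / Z t ^ 2 ≤ 2 * ((δ / (1 - δ)) ^ (1 / (ts : ℝ))) ^ t := by
  classical
  set S : ℝ := δ / (1 - δ) with hSdef
  set ρ : ℝ := S ^ (1 / (ts : ℝ)) with hρdef
  have h1δ : 0 < 1 - δ := by linarith
  have hS0 : 0 ≤ S := div_nonneg hδ0 h1δ.le
  have hS1 : S < 1 := by rw [hSdef, div_lt_one h1δ]; linarith
  have hts0 : (0 : ℝ) < ts := by exact_mod_cast hts
  have hρ0 : 0 ≤ ρ := Real.rpow_nonneg hS0 _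
  have hρ1 : ρ < 1 := Real.rpow_lt_one hS0 hS1 (by positivity)
  have hρpow : ρ ^ ts = S := by
    rw [hρdef, ← Real.rpow_natCast, ← Real.rpow_mul hS0, one_div_mul_cancel hts0.ne', Real.rpow_one]
  refine ⟨hρ0, hρ1, fun t ht => ?_⟩
  -- the top eigenvalue
  obtain ⟨i₀, h0, hmax⟩ := exists_isMax_of_hasSum_pow hμ hts (hZ ts ht₀) hpos
  have hZt := hZ t (ht₀.trans ht)
  have hZ2t := hZ (2 * t) ((ht₀.trans ht).trans (by omega))
  have hZs := hZ ts ht₀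
  have hZ2s := hZ (2 * ts) (ht₀.trans (by omega))
  -- `s_{t*} ≤ S`
  have hs_nonneg : 0 ≤ Z ts / μ i₀ ^ ts - 1 := ratioSum_nonneg hμ h0 hZs
  have hsS : Z ts / μ i₀ ^ ts - 1 ≤ S := by
    have hlow := div_le_defect hs_nonneg (ratioSum_two_mul_le hμ h0 hmax hZs hZ2s)
    rw [← defect_eq h0 ts] at hlow
    have h := hlow.trans hD
    -- `s/(1+s) ≤ δ ⇒ s ≤ δ/(1-δ)`
    set s := Z ts / μ i₀ ^ ts - 1 with hsdef
    have h1s : 0 < 1 + s := by linarith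
    rw [div_le_iff₀ h1s] at h
    rw [hSdef, le_div_iff₀ h1δ]
    linarith
  -- every non-top ratio is `≤ ρ`
  have hrat : ∀ i, i ≠ i₀ → μ i / μ i₀ ≤ ρ := fun i hi => by
    have hri : (μ i / μ i₀) ^ ts ≤ S := (ratio_pow_le_ratioSum hμ h0 hZs hi).trans hsS
    have hr0 : 0 ≤ μ i / μ i₀ := div_nonneg (hμ i) h0.le
    calc μ i / μ i₀ = ((μ i / μ i₀) ^ ts) ^ (1 / (ts : ℝ)) := by
          rw [← Real.rpow_natCast, ← Real.rpow_mul hr0, mul_one_div_cancel hts0.ne', Real.rpow_one]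
      _ ≤ S ^ (1 / (ts : ℝ)) := Real.rpow_le_rpow (pow_nonneg hr0 _) hri (by positivity)
  -- `s_t ≤ ρ^t`
  have hst : Z t / μ i₀ ^ t - 1 ≤ ρ ^ t := by
    calc Z t / μ i₀ ^ t - 1 ≤ ρ ^ (t - ts) * (Z ts / μ i₀ ^ ts - 1) := ratioSum_le_pow_mul hμ h0 hrat ht hZs hZt
      _ ≤ ρ ^ (t - ts) * S := mul_le_mul_of_nonneg_left hsS (pow_nonneg hρ0 _)
      _ = ρ ^ t := by rw [← hρpow, ← pow_add, Nat.sub_add_cancel ht]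
  -- conclude
  have hst0 : 0 ≤ Z t / μ i₀ ^ t - 1 := ratioSum_nonneg hμ h0 hZt
  have hs2t0 : 0 ≤ Z (2 * t) / μ i₀ ^ (2 * t) - 1 := ratioSum_nonneg hμ h0 hZ2t
  rw [defect_eq h0 t]
  exact (defect_le_two_mul hst0 hs2t0).trans (by linarith)

/-- ★ **Purity propagation, exponential form**: under the hypotheses of `defect_le_two_mul_pow_of_defect_le` there
is `c > 0` (namely `−log max(ρ, 1∕2)`) with `1 − Z(2t)∕Z(t)² ≤ 2e^{−ct}` for all `t ≥ t*`. [folklore] -/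
theorem exists_exp_bound_of_defect_le (hμ : ∀ i, 0 ≤ μ i)
    (hZ : ∀ t, t₀ ≤ t → HasSum (fun i => μ i ^ t) (Z t)) {ts : ℕ} (ht₀ : t₀ ≤ ts) (hts : 1 ≤ ts)
    (hpos : 0 < Z ts) {δ : ℝ} (hδ0 : 0 ≤ δ) (hδ : δ < 1 / 2) (hD : 1 - Z (2 * ts) / Z ts ^ 2 ≤ δ) :
    ∃ c : ℝ, 0 < c ∧ ∀ t, ts ≤ t → 1 - Z (2 * t) / Z t ^ 2 ≤ 2 * Real.exp (-(c * (t : ℝ))) := by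
  obtain ⟨hρ0, hρ1, hmain⟩ := defect_le_two_mul_pow_of_defect_le hμ hZ ht₀ hts hpos hδ0 hδ hD
  set ρ : ℝ := (δ / (1 - δ)) ^ (1 / (ts : ℝ)) with hρ
  set ρ' : ℝ := max ρ (1 / 2) with hρ'
  have hρ'pos : 0 < ρ' := lt_of_lt_of_le (by norm_num) (le_max_right _ _)
  have hρ'1 : ρ' < 1 := max_lt hρ1 (by norm_num)
  refine ⟨-Real.log ρ', by rw [neg_pos]; exact Real.log_neg hρ'pos hρ'1, fun t ht => (hmain t ht).trans ?_⟩
  have h : ρ ^ t ≤ Real.exp (-(-Real.log ρ' * (t : ℝ))) := by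
    rw [neg_mul, neg_neg, mul_comm, Real.exp_nat_mul, Real.exp_log hρ'pos]
    exact pow_le_pow_left₀ hρ0 (le_max_left _ _) t
  linarith

end SpectralPurity

end Summit.QuantumFields.YangMills.Cruxes.IRcof.TwistedSlab

end
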